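import Mathlib
import Summits.MatrixMultiplication.MatrixMultiplication.Theses.MatrixPointInterpolation
import Summits.MatrixMultiplication.MatrixMultiplication.Theorems.MatrixPointInterpolationWindowedKaplanskyCapelli
import Literature.Algebra.PolynomialIdentities.ShirshovLemma

/-!
# Crux `TightWindows` (stmt-MatrixMultiplication-18939), line `shirshov-split` — stub `stub_branchI`
# (Branch I: the windowed Shirshov–Kurosh bound)

Registered stub `stub_branchI` of the skeleton of line `shirshov-split`: if every two-letter word
of length `≥ β` contains a `(2k²+1)`-decomposable subword or a power `u^k` with
`0 < |u| ≤ 2k²+1` (the conclusion of Shirshov's Lemma), then for a pair `A : Fin 2 → M_n(ℂ)`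
generating `M_n` in degree `d` (`V_d = M_n`) and satisfying every two-letter identity of `M_k(ℂ)`
supported in degree `≤ 2d`, `k`-algebraicity of the values of all words of length `≤ 2k²+1`
forces `n² < 2^β` (Kanel-Belov–Karasik–Rowen 2015, Prop. 2.2.6 / Theorem 2.2.2, run INSIDE the
degree window).

Proof.  Let `S` be any subspace containing the values `v(A)` of the words of length `< β`.  By
induction on the length-lexicographic order (length first, then the lexicographic order, ranked
on words of equal length by the binary value `Nat.ofDigits 2`), every word `w` of length `≤ 2d` has
`w(A) ∈ S`:
* if `w = a u^k b` with `0 < |u| ≤ 2k²+1`, then `1, U, …, U^k` (`U = u(A)`) are dependent, so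
  `U^k` is a combination of lower powers (`pow_mem_span_of_not_linearIndependent`) and `w(A)` is a
  combination of the values of the strictly shorter words `a u^j b`, `j < k`;
* if `w = a · ws_0 ⋯ ws_{m-1} · b` with `m = 2k²+1` pieces every non-trivial rearrangement of
  which is lexicographically smaller, we use the multilinear alternating identity
  `∑_σ sgn σ · x_{σ 0} ⋯ x_{σ (m-1)} = 0` of `M_k(ℂ)` (`m > k² = dim M_k(ℂ)`,
  `sum_sign_smul_prod_perm_eq_zero`): the polynomial `∑_σ sgn σ · a · ws_{σ 0} ⋯ ws_{σ(m-1)} · b`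
  is an identity of `M_k` (`eval₂_sum_sign_single_matrix`) supported in degree `|w| ≤ 2d`, hence
  vanishes at `A` by the window (`Masquerade.window_eval₂`), which expresses `w(A)` through the
  values of words of the same length that are lexicographically smaller.
Taking `S = V_{β-1}` (resp. `S = ⊥` if `β = 0`) gives `M_n = V_d ≤ V_{β-1}`, and the word count
`Masquerade.finrank_wordSpan_le` gives `n² ≤ 2^β - 1`.
-/

set_option linter.dupNamespace false
-- `MatrixMultiplication.MatrixMultiplication` is the summit/sub-problem path (D-0017)

namespace Summit.MatrixMultiplication.MatrixMultiplication.Theorems.TightWindows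

open scoped BigOperators
open Summit.MatrixMultiplication.MatrixMultiplication.Theorems.Masquerade MonoidAlgebra Equiv

/-! ### A rank function for the lexicographic order on words of equal length -/

/-- The binary value `ofDigits 2` of (the reversal of) a word: prepending a letter `a` to a word
`x` adds `2^|x| · a`. [folklore] -/
theorem ofDigits_word_cons (a : Fin 2) (x : List (Fin 2)) :
    Nat.ofDigits (2 : ℕ) ((a :: x).map Fin.val).reverse =
      Nat.ofDigits (2 : ℕ) (x.map Fin.val).reverse + 2 ^ x.length * (a : ℕ) := by
  simp [List.reverse_cons, Nat.ofDigits_append]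

/-- The binary value of a word of length `N` is `< 2^N`. [folklore] -/
theorem ofDigits_word_lt (x : List (Fin 2)) :
    Nat.ofDigits (2 : ℕ) (x.map Fin.val).reverse < 2 ^ x.length := by
  have h := Nat.ofDigits_lt_base_pow_length (b := 2) (l := (x.map Fin.val).reverse) (by norm_num)
    (fun d hd => by
      simp only [List.mem_reverse, List.mem_map] at hd
      obtain ⟨i, -, rfl⟩ := hd
      exact i.is_lt)
  simpa using h

/-- On words of equal length the lexicographic order is the order of binary values; this ranks
the lexicographic order on words of a fixed length by natural numbers. [folklore] -/
theorem ofDigits_word_lt_of_lt :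
    ∀ {x y : List (Fin 2)}, x < y → x.length = y.length →
      Nat.ofDigits (2 : ℕ) (x.map Fin.val).reverse < Nat.ofDigits (2 : ℕ) (y.map Fin.val).reverse
  | [], [], h, _ => (List.not_lt_nil _ h).elim
  | [], _ :: _, _, hl => by simp at hl
  | _ :: _, [], _, hl => by simp at hl
  | a :: x, b :: y, h, hl => by
      simp only [List.cons_lt_cons_iff] at h
      simp only [List.length_cons, Nat.add_right_cancel_iff] at hl
      rw [ofDigits_word_cons, ofDigits_word_cons]
      rcases h with h | ⟨rfl, h⟩
      · have hab : (a : ℕ) + 1 ≤ b := h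
        have hx := ofDigits_word_lt x
        have h1 : 2 ^ y.length * (a : ℕ) + 2 ^ y.length ≤ 2 ^ y.length * (b : ℕ) := by
          rw [← mul_add_one]
          exact Nat.mul_le_mul_left _ hab
        rw [hl] at hx ⊢
        omega
      · rw [hl]
        exact Nat.add_lt_add_right (ofDigits_word_lt_of_lt h hl) _

/-! ### `k`-algebraicity: the top power is a combination of the lower ones -/

/-- If `1, U, …, U^k` are linearly dependent then `U^k` lies in the span of `1, U, …, U^{k-1}`
(for `k = 0`: then `1 = 0`). [folklore] -/
theorem pow_mem_span_of_not_linearIndependent {R : Type*} [Ring R] [Algebra ℂ R] (U : R) :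
    ∀ k : ℕ, ¬ LinearIndependent ℂ (fun j : Fin (k + 1) => U ^ (j : ℕ)) →
      U ^ k ∈ Submodule.span ℂ (Set.range fun j : Fin k => U ^ (j : ℕ))
  | 0, h => by
      change ¬ LinearIndependent ℂ (fun j : Fin 1 => U ^ (j : ℕ)) at h
      rw [linearIndependent_unique_iff, not_not] at h
      simp only [Fin.default_eq_zero, Fin.val_zero] at h
      rw [h]
      exact Submodule.zero_mem _
  | k + 1, h => by
      rw [linearIndependent_finSucc', not_and_or, not_not] at h
      have hinit :
          Fin.init (fun j : Fin (k + 2) => U ^ (j : ℕ)) = fun j : Fin (k + 1) => U ^ (j : ℕ) :=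
        rfl
      rw [hinit] at h
      simp only [Fin.val_last] at h
      rcases h with h | h
      · have ih := pow_mem_span_of_not_linearIndependent U k h
        have hle : Submodule.span ℂ (Set.range fun j : Fin k => U ^ (j : ℕ)) ≤
            (Submodule.span ℂ (Set.range fun j : Fin (k + 1) => U ^ (j : ℕ))).comap
              (LinearMap.mulLeft ℂ U) := by
          rw [Submodule.span_le]
          rintro _ ⟨j, rfl⟩
          rw [SetLike.mem_coe, Submodule.mem_comap, LinearMap.mulLeft_apply, ← pow_succ']
          exact Submodule.subset_span ⟨j.succ, rfl⟩
        rw [pow_succ']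
        exact hle ih
      · exact h

/-! ### The multilinear alternating identity of `M_k(ℂ)` in `m > k²` arguments -/

/-- **Alternating sums of products vanish on `M_k(ℂ)` beyond the dimension.**  For `m > k²` and
`P_0, …, P_{m-1} ∈ M_k(ℂ)`, `∑_σ sgn σ · P_{σ 0} ⋯ P_{σ (m-1)} = 0`: the left side is the
alternatisation of the multilinear map `t ↦ t_0 ⋯ t_{m-1}`, evaluated at `m > dim M_k(ℂ)`
necessarily dependent arguments. [folklore] -/
theorem sum_sign_smul_prod_perm_eq_zero {k m : ℕ} (hm : k * k < m)
    (P : Fin m → Matrix (Fin k) (Fin k) ℂ) :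
    ∑ σ : Perm (Fin m), ((Perm.sign σ : ℤ) : ℂ) • (List.ofFn fun i => P (σ i)).prod = 0 := by
  have hli : ¬ LinearIndependent ℂ P := fun hP => by
    have h := hP.fintype_card_le_finrank
    simp only [Module.finrank_matrix, Fintype.card_fin, Module.finrank_self, mul_one] at h
    omega
  have h0 := AlternatingMap.map_linearDependent
    (MultilinearMap.alternatization
      (MultilinearMap.mkPiAlgebraFin ℂ m (Matrix (Fin k) (Fin k) ℂ))) P hli
  rw [MultilinearMap.alternatization_apply] at h0
  rw [← h0]
  refine Finset.sum_congr rfl fun σ _ => ?_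
  rw [MultilinearMap.domDomCongr_apply, MultilinearMap.mkPiAlgebraFin_apply, Units.smul_def,
    Int.cast_smul_eq_zsmul]

/-! ### The rewriting polynomial of a word cut into pieces -/

/-- Rearranging the pieces does not change the length of their concatenation. [folklore] -/
theorem length_flatten_ofFn_perm {α : Type*} {m : ℕ} (ws : Fin m → List α) (σ : Perm (Fin m)) :
    (List.ofFn fun i => ws (σ i)).flatten.length = (List.ofFn ws).flatten.length := by
  simp only [List.length_flatten, List.map_ofFn, List.sum_ofFn, Function.comp_apply]
  exact Equiv.sum_comp σ (fun i => (ws i).length)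

/-- The value of a word cut into pieces is the product of the values of the pieces. [folklore] -/
theorem prod_map_pieces {R : Type*} [Monoid R] (E : Fin 2 → R) {m : ℕ} (a b : List (Fin 2))
    (f : Fin m → List (Fin 2)) :
    ((a ++ (List.ofFn f).flatten ++ b).map E).prod =
      (a.map E).prod * (List.ofFn fun i => ((f i).map E).prod).prod * (b.map E).prod := by
  simp [List.prod_flatten, List.map_ofFn, Function.comp_def, mul_assoc]

/-- The length of `a u^j b`. [folklore] -/
theorem length_power_word {α : Type*} (a b u : List α) (j : ℕ) :
    (a ++ (List.replicate j u).flatten ++ b).length = a.length + j * u.length + b.length := by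
  simp only [List.length_append, List.length_flatten, List.map_replicate, List.sum_replicate,
    smul_eq_mul]

/-- The rewriting polynomial `∑_σ sgn σ · a · ws_{σ 0} ⋯ ws_{σ (m-1)} · b` of the word
`a · ws_0 ⋯ ws_{m-1} · b` cut into `m` middle pieces is supported on words of the length of the
word it rewrites. [folklore] -/
theorem deg_sum_sign_single_le {m : ℕ} (a b : List (Fin 2)) (ws : Fin m → List (Fin 2)) :
    deg (∑ σ : Perm (Fin m),
      single (FreeMonoid.ofList (a ++ (List.ofFn fun i => ws (σ i)).flatten ++ b))
        ((Perm.sign σ : ℤ) : ℂ)) ≤ (a ++ (List.ofFn ws).flatten ++ b).length := by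
  refine deg_sum_le fun σ _ => (deg_single_le _ _).trans (le_of_eq ?_)
  show (a ++ (List.ofFn fun i => ws (σ i)).flatten ++ b).length = _
  simp only [List.length_append, length_flatten_ofFn_perm]

/-- **The rewriting polynomial is an identity of `M_k(ℂ)`** as soon as the number `m` of pieces
exceeds `k²`: its value at `B` is `a(B) · (∑_σ sgn σ · P_{σ 0} ⋯ P_{σ(m-1)}) · b(B)` with `P_i`
the values of the pieces, and the middle factor vanishes (`sum_sign_smul_prod_perm_eq_zero`).
[cite: KanelBelovKarasikRowen2015, Prop. 2.2.6] -/
theorem eval₂_sum_sign_single_matrix {k m : ℕ} (hm : k * k < m)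
    (B : Fin 2 → Matrix (Fin k) (Fin k) ℂ) (a b : List (Fin 2)) (ws : Fin m → List (Fin 2)) :
    eval₂ B (∑ σ : Perm (Fin m),
      single (FreeMonoid.ofList (a ++ (List.ofFn fun i => ws (σ i)).flatten ++ b))
        ((Perm.sign σ : ℤ) : ℂ)) = 0 := by
  have h := sum_sign_smul_prod_perm_eq_zero hm (fun i => ((ws i).map B).prod)
  have key : ∀ σ : Perm (Fin m),
      eval₂ B (single (FreeMonoid.ofList (a ++ (List.ofFn fun i => ws (σ i)).flatten ++ b))
        ((Perm.sign σ : ℤ) : ℂ)) =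
        (a.map B).prod *
          (((Perm.sign σ : ℤ) : ℂ) • (List.ofFn fun i => ((ws (σ i)).map B).prod).prod) *
          (b.map B).prod := by
    intro σ
    rw [eval₂_single, FreeMonoid.toList_ofList, prod_map_pieces, mul_smul_comm, smul_mul_assoc]
  rw [map_sum]
  simp_rw [key, ← Finset.sum_mul, ← Finset.mul_sum, h, mul_zero, zero_mul]

/-! ### The induction over the length-lexicographic order -/

/-- **Windowed Shirshov–Kurosh reduction.**  Under the hypotheses of the stub, every subspace `S`
containing the values at `A` of the words of length `< β` contains the values of all words of
length `≤ 2d`: longer words are rewritten inside the window, power subwords by `k`-algebraicity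
(strictly shorter words) and decomposable subwords by the alternating identity of `M_k(ℂ)` in
`2k²+1 > k²` arguments (lexicographically smaller words of the same length).
[cite: KanelBelovKarasikRowen2015, Prop. 2.2.6] -/
theorem prod_mem_of_shirshov {k β n d : ℕ} {A : Fin 2 → Matrix (Fin n) (Fin n) ℂ}
    (hβ : ∀ w : List (Fin 2), β ≤ w.length →
      (∃ (a b : List (Fin 2)) (ws : Fin (2 * k ^ 2 + 1) → List (Fin 2)), (∀ i, ws i ≠ []) ∧
        (∀ σ : Equiv.Perm (Fin (2 * k ^ 2 + 1)), σ ≠ 1 →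
          (List.ofFn (fun i => ws (σ i))).flatten < (List.ofFn ws).flatten) ∧
        w = a ++ (List.ofFn ws).flatten ++ b) ∨
      (∃ (a b u : List (Fin 2)), u ≠ [] ∧ u.length ≤ 2 * k ^ 2 + 1 ∧
        w = a ++ (List.replicate k u).flatten ++ b))
    (hwin : ∀ (T : Finset (List (Fin 2))) (c : List (Fin 2) → ℂ), (∀ w ∈ T, w.length ≤ 2 * d) →
      (∀ B : Fin 2 → Matrix (Fin k) (Fin k) ℂ, (∑ w ∈ T, c w • (w.map B).prod) = 0) →
      (∑ w ∈ T, c w • (w.map A).prod) = 0)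
    (hall : ∀ u : List (Fin 2), u.length ≤ 2 * k ^ 2 + 1 →
      ¬ LinearIndependent ℂ (fun j : Fin (k + 1) => ((u.map A).prod) ^ (j : ℕ)))
    (S : Submodule ℂ (Matrix (Fin n) (Fin n) ℂ))
    (hbase : ∀ v : List (Fin 2), v.length < β → (v.map A).prod ∈ S) :
    ∀ w : List (Fin 2), w.length ≤ 2 * d → (w.map A).prod ∈ S := by
  -- induction on the length `N`, then on the rank `V` of `w` in the lexicographic order
  suffices H : ∀ N V : ℕ, ∀ w : List (Fin 2), w.length = N →
      Nat.ofDigits (2 : ℕ) (w.map Fin.val).reverse = V → N ≤ 2 * d → (w.map A).prod ∈ S from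
    fun w hw => H _ _ w rfl rfl hw
  intro N
  induction N using Nat.strong_induction_on with
  | _ N ihN =>
  intro V
  induction V using Nat.strong_induction_on with
  | _ V ihV =>
  intro w hwN hwV hN
  by_cases hwβ : w.length < β
  · exact hbase w hwβ
  rcases hβ w (not_lt.1 hwβ) with ⟨a, b, ws, -, hlex, rfl⟩ | ⟨a, b, u, hu, hum, rfl⟩
  · -- a decomposable subword: rewrite with the alternating identity inside the window
    have hlenσ : ∀ σ : Perm (Fin (2 * k ^ 2 + 1)),
        (a ++ (List.ofFn fun i => ws (σ i)).flatten ++ b).length = N := fun σ => by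
      rw [← hwN]
      simp only [List.length_append, length_flatten_ofFn_perm]
    have hmem : ∀ σ : Perm (Fin (2 * k ^ 2 + 1)), σ ≠ 1 →
        ((a ++ (List.ofFn fun i => ws (σ i)).flatten ++ b).map A).prod ∈ S := fun σ hσ => by
      refine ihV _ ?_ _ (hlenσ σ) rfl hN
      rw [← hwV]
      refine ofDigits_word_lt_of_lt ?_ ((hlenσ σ).trans hwN.symm)
      simp only [List.append_assoc]
      exact List.Lex.append_left _
        (Literature.Algebra.PolynomialIdentities.Shirshov.append_lt_append_of_lt (hlex σ hσ)
          (length_flatten_ofFn_perm ws σ) b b) a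
    have hkm : k * k < 2 * k ^ 2 + 1 := by nlinarith [sq_nonneg k, sq k]
    have hvan := window_eval₂ hwin _ ((deg_sum_sign_single_le a b ws).trans (hwN.le.trans hN))
      fun B => eval₂_sum_sign_single_matrix hkm B a b ws
    rw [map_sum, ← Finset.add_sum_erase _ _ (Finset.mem_univ (1 : Perm (Fin (2 * k ^ 2 + 1))))]
      at hvan
    simp only [eval₂_single, FreeMonoid.toList_ofList, Perm.sign_one, Units.val_one, Int.cast_one,
      one_smul, Perm.coe_one, id_eq] at hvan
    rw [eq_neg_of_add_eq_zero_left hvan]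
    refine Submodule.neg_mem _ (Submodule.sum_mem _ fun σ hσ => Submodule.smul_mem _ _ ?_)
    exact hmem σ (Finset.ne_of_mem_erase hσ)
  · -- a power subword: shorten it by `k`-algebraicity
    set U := (u.map A).prod with hU
    obtain ⟨c, hc⟩ := (Submodule.mem_span_range_iff_exists_fun ℂ).1
      (pow_mem_span_of_not_linearIndependent U k (hall u hum))
    have hprod : ∀ j : ℕ, ((a ++ (List.replicate j u).flatten ++ b).map A).prod =
        (a.map A).prod * U ^ j * (b.map A).prod := fun j => by
      simp [hU, List.prod_flatten, List.map_replicate, List.prod_replicate, mul_assoc]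
    rw [hprod k, ← hc, Finset.mul_sum, Finset.sum_mul]
    refine Submodule.sum_mem _ fun j _ => ?_
    rw [mul_smul_comm, smul_mul_assoc, ← hprod j]
    have hlt : (a ++ (List.replicate (j : ℕ) u).flatten ++ b).length < N := by
      rw [← hwN, length_power_word, length_power_word]
      have h1 := Nat.mul_le_mul_right u.length (show (j : ℕ) + 1 ≤ k from j.is_lt)
      have h2 : 0 < u.length := List.length_pos_of_ne_nil hu
      nlinarith
    exact Submodule.smul_mem _ _ (ihN _ hlt _ _ rfl rfl (hlt.le.trans hN))

/-! ### The stub -/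

/-- **Branch I: the windowed Shirshov–Kurosh bound** (registered stub `stub_branchI` of line
`shirshov-split`).  If every word of length `≥ β` in two letters has a `(2k²+1)`-decomposable
subword or a subword `u^k` with `0 < |u| ≤ 2k²+1` (the conclusion of Shirshov's Lemma for
`(r, m, q) = (2, 2k²+1, k)`), then at a pair `A` generating `M_n` in degree `d` and satisfying
every two-letter identity of `M_k` of degree `≤ 2d`, `k`-algebraicity of all words of length
`≤ 2k²+1` forces `n² < 2^β`: by `prod_mem_of_shirshov`, `M_n = V_d ≤ V_{β-1}` (`≤ ⊥` if `β = 0`),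
and `dim V_{β-1} ≤ 2^β - 1` (`Masquerade.finrank_wordSpan_le`).
[cite: KanelBelovKarasikRowen2015, Prop. 2.2.6] -/
theorem stub_branchI : ∀ (k β : ℕ),
    (∀ w : List (Fin 2), β ≤ w.length →
      (∃ (a b : List (Fin 2)) (ws : Fin (2 * k ^ 2 + 1) → List (Fin 2)), (∀ i, ws i ≠ []) ∧
        (∀ σ : Equiv.Perm (Fin (2 * k ^ 2 + 1)), σ ≠ 1 →
          (List.ofFn (fun i => ws (σ i))).flatten < (List.ofFn ws).flatten) ∧
        w = a ++ (List.ofFn ws).flatten ++ b) ∨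
      (∃ (a b u : List (Fin 2)), u ≠ [] ∧ u.length ≤ 2 * k ^ 2 + 1 ∧
        w = a ++ (List.replicate k u).flatten ++ b)) →
    ∀ (n d : ℕ) (A : Fin 2 → Matrix (Fin n) (Fin n) ℂ),
    Submodule.span ℂ {M : Matrix (Fin n) (Fin n) ℂ |
      ∃ w : List (Fin 2), w.length ≤ d ∧ (w.map A).prod = M} = ⊤ →
    (∀ (T : Finset (List (Fin 2))) (c : List (Fin 2) → ℂ), (∀ w ∈ T, w.length ≤ 2 * d) →
      (∀ B : Fin 2 → Matrix (Fin k) (Fin k) ℂ, (∑ w ∈ T, c w • (w.map B).prod) = 0) →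
      (∑ w ∈ T, c w • (w.map A).prod) = 0) →
    (∀ u : List (Fin 2), u.length ≤ 2 * k ^ 2 + 1 →
      ¬ LinearIndependent ℂ (fun j : Fin (k + 1) => ((u.map A).prod) ^ (j : ℕ))) →
    n ^ 2 < 2 ^ β := by
  intro k β hβ n d A hspan hwin hall
  -- `V_d ≤ S` for every subspace `S` containing the values of the words of length `< β`
  have hle : ∀ S : Submodule ℂ (Matrix (Fin n) (Fin n) ℂ),
      (∀ v : List (Fin 2), v.length < β → (v.map A).prod ∈ S) → ⊤ ≤ S := fun S hS => by
    rw [← hspan, Submodule.span_le]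
    rintro M ⟨w, hw, rfl⟩
    exact prod_mem_of_shirshov hβ hwin hall S hS w (by omega)
  cases β with
  | zero =>
    -- no short words: `M_n = ⊥`, so `n = 0`
    have h1 : (1 : Matrix (Fin n) (Fin n) ℂ) ∈ (⊥ : Submodule ℂ (Matrix (Fin n) (Fin n) ℂ)) :=
      hle ⊥ (fun v hv => absurd hv (Nat.not_lt_zero _)) Submodule.mem_top
    rw [Submodule.mem_bot] at h1
    rcases Nat.eq_zero_or_pos n with hn | hn
    · subst hn
      simp
    · exact absurd (congr_fun (congr_fun h1 ⟨0, hn⟩) ⟨0, hn⟩) (by simp)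
  | succ γ =>
    have htop : wordSpan A γ = ⊤ :=
      eq_top_iff.2 (hle _ fun v hv => prod_mem_wordSpan A v (Nat.lt_succ_iff.1 hv))
    have h1 := sq_le_of_wordSpan_eq_top htop
    have h2 : 1 ≤ 2 ^ (γ + 1) := Nat.one_le_two_pow
    omega

end Summit.MatrixMultiplication.MatrixMultiplication.Theorems.TightWindows
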